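import Summits.MatrixMultiplication.OmegaCensus.DominoZ5LineTables
import HarnessLib

/-!
# Generic kit for multisets on `ZMod p × ZMod p`: points, the `p + 1` line directions, digit codes, search trees

ω-census `pub-omega`, family (b3), seat pub-omega-group gen 20.  Framing: lottery ticket; floor = certified bounds/negative
ranges.  VALUE: infrastructure (generic in `p`) for the kernel cover computations behind the `ℤ_p × ℤ_p` domino cell
theorems (`DominoZpZpCover.lean`, `DominoZpZpCells.lean`); NOT progress on ω.

A multiset `F` on `ZMod p × ZMod p` is coded by its `p²` values `g i = F (pt p i)`, `pt p i = (i / p, i % p)` (`ptEquiv`).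
The `p + 1` line directions are `j = 0 ↦ u₁` and `j = k + 1 ↦ k·u₁ + u₂` (`lineDir`, value table `pv`, `lineDir_pt_val`
proved for every `p`, no `decide`).  A count vector `(c₀, …, c_{p−1})` is packed in base `B` as `polyBE B [c₀, …] =
Σ c_v B^{p−1−v}` (`polyBE_inj`: injective on digit lists of equal length with digits `< B`).  `BTree` is a plain binary
search tree of naturals used as a FAST membership heuristic inside kernel enumerations; nothing about it is trusted — its
answers are re-checked extensionally by `decide` where they are used.  `wt p B i` is the list, over the directions `j ≤ p`,
of the weights `B^{p−1−pv p j i}` of cell `i`, and `rowWs p B` groups them by rows `t = i / p`.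
-/

namespace Summit.MatrixMultiplication.OmegaCensus

open Finset

namespace ZpZpDomino

/-! ## Points -/

/-- The point of `ZMod p × ZMod p` with number `i < p²`: `(i / p, i % p)`. [folklore] -/
def pt (p i : ℕ) : ZMod p × ZMod p := (((i / p : ℕ) : ZMod p), ((i % p : ℕ) : ZMod p))

/-- The inverse numbering `u ↦ p·u₁ + u₂`. [folklore] -/
def ptIdx (p : ℕ) [NeZero p] (u : ZMod p × ZMod p) : ℕ := p * u.1.val + u.2.val

/-- `ptIdx` lands below `p²`. [folklore] -/
theorem ptIdx_lt (p : ℕ) [NeZero p] (u : ZMod p × ZMod p) : ptIdx p u < p * p := by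
  unfold ptIdx
  have h1 := u.1.val_lt
  have h2 := u.2.val_lt
  calc p * u.1.val + u.2.val < p * u.1.val + p := by omega
    _ = p * (u.1.val + 1) := by ring
    _ ≤ p * p := Nat.mul_le_mul_left _ h1

/-- `pt ∘ ptIdx = id`. [folklore] -/
theorem pt_ptIdx (p : ℕ) [NeZero p] (u : ZMod p × ZMod p) : pt p (ptIdx p u) = u := by
  have hp : 0 < p := Nat.pos_of_ne_zero (NeZero.ne p)
  have h2 := u.2.val_lt
  unfold pt ptIdx
  have e1 : (p * u.1.val + u.2.val) / p = u.1.val := by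
    rw [show p * u.1.val + u.2.val = u.2.val + u.1.val * p by ring, Nat.add_mul_div_right _ _ hp,
      Nat.div_eq_of_lt h2, zero_add]
  have e2 : (p * u.1.val + u.2.val) % p = u.2.val := by
    rw [show p * u.1.val + u.2.val = u.2.val + u.1.val * p by ring, Nat.add_mul_mod_self_right,
      Nat.mod_eq_of_lt h2]
  rw [e1, e2, ZMod.natCast_zmod_val, ZMod.natCast_zmod_val]

/-- `ptIdx ∘ pt = id` below `p²`. [folklore] -/
theorem ptIdx_pt (p : ℕ) [NeZero p] {i : ℕ} (hi : i < p * p) : ptIdx p (pt p i) = i := by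
  have hp : 0 < p := Nat.pos_of_ne_zero (NeZero.ne p)
  unfold pt ptIdx
  simp only [ZMod.val_natCast]
  rw [Nat.mod_eq_of_lt (Nat.div_lt_of_lt_mul hi), Nat.mod_eq_of_lt (Nat.mod_lt i hp)]
  exact Nat.div_add_mod i p

/-- The numbering of `ZMod p × ZMod p` by `Fin (p * p)`. [folklore] -/
def ptEquiv (p : ℕ) [NeZero p] : Fin (p * p) ≃ ZMod p × ZMod p where
  toFun i := pt p i.val
  invFun u := ⟨ptIdx p u, ptIdx_lt p u⟩
  left_inv i := Fin.ext (ptIdx_pt p i.isLt)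
  right_inv u := pt_ptIdx p u

/-- A sum over `ZMod p × ZMod p` as a sum over the `p²` numbered points. [folklore] -/
theorem sum_eq_sum_pt (p : ℕ) [NeZero p] (H : ZMod p × ZMod p → ℕ) :
    ∑ u, H u = ∑ i : Fin (p * p), H (pt p i.val) :=
  (Fintype.sum_equiv (ptEquiv p) (fun i => H (pt p i.val)) H fun _ => rfl).symm

/-! ## Directions -/

/-- First coordinate of direction `j`: `j = 0 ↦ (1, 0)`, `j = k + 1 ↦ (k, 1)`. [folklore] -/
def dirFst (j : ℕ) : ℕ := if j = 0 then 1 else j - 1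

/-- Second coordinate of direction `j`. [folklore] -/
def dirSnd (j : ℕ) : ℕ := if j = 0 then 0 else 1

/-- The linear form `u ↦ a·u₁ + b·u₂` on `ZMod q × ZMod q`. [folklore] -/
def lmap {q : ℕ} (a b : ZMod q) : ZMod q × ZMod q →+ ZMod q where
  toFun u := a * u.1 + b * u.2
  map_zero' := by simp
  map_add' x y := by simp only [Prod.fst_add, Prod.snd_add]; ring

/-- Applying `lmap`. [folklore] -/
@[simp] theorem lmap_apply {q : ℕ} (a b : ZMod q) (u : ZMod q × ZMod q) : lmap a b u = a * u.1 + b * u.2 := rfl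

/-- The line form of direction `j ≤ p` on `ZMod p × ZMod p`. [folklore] -/
def lineDir (p j : ℕ) : ZMod p × ZMod p →+ ZMod p := lmap ((dirFst j : ℕ) : ZMod p) ((dirSnd j : ℕ) : ZMod p)

/-- Every line form is onto. [folklore] -/
theorem lineDir_surjective (p j : ℕ) : Function.Surjective (lineDir p j) := by
  intro t
  by_cases hj : j = 0
  · exact ⟨(t, 0), by simp [lineDir, dirFst, dirSnd, hj]⟩
  · exact ⟨(0, t), by simp [lineDir, dirFst, dirSnd, hj]⟩

/-- A line form commutes with scalars. [folklore] -/
theorem lineDir_smul (p j : ℕ) (c : ZMod p) (u : ZMod p × ZMod p) :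
    lineDir p j (c • u) = c * lineDir p j u := by
  simp only [lineDir, lmap_apply, Prod.smul_fst, Prod.smul_snd, smul_eq_mul]
  ring

/-- Projection value of point `i` in direction `j`, computed in `ℕ`. [folklore] -/
def pv (p j i : ℕ) : ℕ := (dirFst j * (i / p) + dirSnd j * (i % p)) % p

/-- `pv` is a residue. [folklore] -/
theorem pv_lt (p : ℕ) [NeZero p] (j i : ℕ) : pv p j i < p := Nat.mod_lt _ (Nat.pos_of_ne_zero (NeZero.ne p))

/-- `pv` computes the line form (for every `p`; no case analysis). [folklore] -/
theorem lineDir_pt_val (p : ℕ) [NeZero p] (j i : ℕ) : (lineDir p j (pt p i)).val = pv p j i := by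
  unfold lineDir pt pv
  rw [lmap_apply]
  simp only
  rw [← Nat.cast_mul, ← Nat.cast_mul, ← Nat.cast_add, ZMod.val_natCast]

/-- The row direction: `pv p 0 i = (i / p) % p`. [folklore] -/
theorem pv_zero (p i : ℕ) : pv p 0 i = i / p % p := by simp [pv, dirFst, dirSnd]

/-- Line form value of a point versus `pv`. [folklore] -/
theorem lineDir_pt_eq_iff (p : ℕ) [NeZero p] (j i : ℕ) {v : ℕ} (hv : v < p) :
    lineDir p j (pt p i) = ((v : ℕ) : ZMod p) ↔ pv p j i = v := by
  have h := lineDir_pt_val p j i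
  constructor
  · intro e
    rw [e, ZMod.val_natCast, Nat.mod_eq_of_lt hv] at h
    exact h.symm
  · intro e
    apply ZMod.val_injective p
    rw [h, e, ZMod.val_natCast, Nat.mod_eq_of_lt hv]

/-- `pick v b a = a` if `b = v`, else `0`. [folklore] -/
def pick (v b a : ℕ) : ℕ := if b = v then a else 0

/-- The filtered sum along direction `j` as a `pick`-sum over the numbered points. [folklore] -/
theorem sum_filter_eq_sum_pick (p : ℕ) [NeZero p] (j : ℕ) (H : ZMod p × ZMod p → ℕ) {v : ℕ} (hv : v < p) :
    ∑ u ∈ univ.filter (fun u => lineDir p j u = ((v : ℕ) : ZMod p)), H u =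
      ∑ i : Fin (p * p), pick v (pv p j i.val) (H (pt p i.val)) := by
  rw [sum_filter, sum_eq_sum_pt]
  refine Fintype.sum_congr _ _ fun i => ?_
  unfold pick
  by_cases hc : pv p j i.val = v
  · rw [if_pos ((lineDir_pt_eq_iff p j i.val hv).2 hc), if_pos hc]
  · rw [if_neg (fun e => hc ((lineDir_pt_eq_iff p j i.val hv).1 e)), if_neg hc]

/-! ## Base-`B` digit codes -/

/-- Big-endian base-`B` value of a digit list: `polyBE B [c₀, …, c_{n−1}] = Σ c_k B^{n−1−k}`. [folklore] -/
def polyBE (B : ℕ) : List ℕ → ℕ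
  | [] => 0
  | c :: l => c * B ^ l.length + polyBE B l

/-- A digit list with digits `< B` codes below `B ^ length`. [folklore] -/
theorem polyBE_lt {B : ℕ} : ∀ {l : List ℕ}, (∀ x ∈ l, x < B) → polyBE B l < B ^ l.length
  | [], _ => by simp [polyBE]
  | c :: l, h => by
    have hc : c < B := h c (by simp)
    have ih := polyBE_lt (l := l) fun x hx => h x (by simp [hx])
    simp only [polyBE, List.length_cons, pow_succ]
    calc c * B ^ l.length + polyBE B l < c * B ^ l.length + B ^ l.length := by omega
      _ = (c + 1) * B ^ l.length := by ring
      _ ≤ B * B ^ l.length := Nat.mul_le_mul_right _ hc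
      _ = B ^ l.length * B := by ring

/-- **`polyBE` is injective** on digit lists of equal length with digits `< B`. [folklore] -/
theorem polyBE_inj {B : ℕ} : ∀ {l m : List ℕ}, l.length = m.length → (∀ x ∈ l, x < B) → (∀ x ∈ m, x < B) →
    polyBE B l = polyBE B m → l = m
  | [], [], _, _, _, _ => rfl
  | [], _ :: _, h, _, _, _ => by simp at h
  | _ :: _, [], h, _, _, _ => by simp at h
  | c :: l, c' :: m, hlen, hl, hm, he => by
    simp only [List.length_cons, Nat.add_right_cancel_iff] at hlen
    have hl' : ∀ x ∈ l, x < B := fun x hx => hl x (by simp [hx])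
    have hm' : ∀ x ∈ m, x < B := fun x hx => hm x (by simp [hx])
    have h1 := polyBE_lt hl'
    have h2 := polyBE_lt hm'
    simp only [polyBE] at he
    rw [hlen] at he h1
    have hN : 0 < B ^ m.length := by omega
    have d1 : (c * B ^ m.length + polyBE B l) / B ^ m.length = c := by
      rw [show c * B ^ m.length + polyBE B l = polyBE B l + c * B ^ m.length by ring,
        Nat.add_mul_div_right _ _ hN, Nat.div_eq_of_lt h1, zero_add]
    have d2 : (c' * B ^ m.length + polyBE B m) / B ^ m.length = c' := by
      rw [show c' * B ^ m.length + polyBE B m = polyBE B m + c' * B ^ m.length by ring,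
        Nat.add_mul_div_right _ _ hN, Nat.div_eq_of_lt h2, zero_add]
    have hc : c = c' := by rw [← d1, he, d2]
    subst hc
    have hr : polyBE B l = polyBE B m := by omega
    rw [polyBE_inj hlen hl' hm' hr]

/-- `polyBE` of `List.ofFn`: the weighted digit sum. [folklore] -/
theorem polyBE_ofFn (B : ℕ) : ∀ (n : ℕ) (f : Fin n → ℕ),
    polyBE B (List.ofFn f) = ∑ v : Fin n, f v * B ^ (n - 1 - v.val)
  | 0, f => by simp [polyBE]
  | n + 1, f => by
    rw [List.ofFn_succ, polyBE, Fin.sum_univ_succ, polyBE_ofFn B n]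
    simp only [List.length_ofFn, Fin.val_zero, Nat.sub_zero, Nat.add_sub_cancel, Fin.val_succ]
    congr 1
    refine Fintype.sum_congr _ _ fun i => ?_
    rw [show n - (i.val + 1) = n - 1 - i.val by omega]

/-! ## Binary search trees (untrusted membership heuristic) -/

/-- A binary search tree of naturals. [folklore] -/
inductive BTree where
  /-- the empty tree -/
  | nil : BTree
  /-- a node with left subtree, key, right subtree -/
  | node : BTree → ℕ → BTree → BTree

/-- Search-tree membership (correct only on ordered trees; never trusted, always re-checked by `decide`). [folklore] -/
def BTree.mem : BTree → ℕ → Bool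
  | .nil, _ => false
  | .node l k r, x => if x < k then l.mem x else if k < x then r.mem x else true

/-- Search-tree insertion. [folklore] -/
def BTree.insert : BTree → ℕ → BTree
  | .nil, x => .node .nil x .nil
  | .node l k r, x => if x < k then .node (l.insert x) k r else if k < x then .node l k (r.insert x) else .node l k r

/-- The search tree of a list of keys (insert in the given order). [folklore] -/
def BTree.ofList (l : List ℕ) : BTree := l.foldl BTree.insert .nil

/-! ## Cell weights -/

/-- Weight vector of cell `i`: for each direction `j ≤ p`, `B^{p−1−pv p j i}`. [folklore] -/
def wt (p B i : ℕ) : List ℕ := (List.range (p + 1)).map fun j => B ^ (p - 1 - pv p j i)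

/-- Weights of the cells `t·p + u`, `u < p`, of row `t`. [folklore] -/
def rowW (p B t : ℕ) : List (List ℕ) := (List.range p).map fun u => wt p B (t * p + u)

/-- Weights of all rows `t < p`. [folklore] -/
def rowWs (p B : ℕ) : List (List (List ℕ)) := (List.range p).map fun t => rowW p B t

/-- Length of `wt`. [folklore] -/
@[simp] theorem length_wt (p B i : ℕ) : (wt p B i).length = p + 1 := by simp [wt]

/-- Entries of `wt`. [folklore] -/
theorem getD_wt (p B i : ℕ) {j : ℕ} (hj : j < p + 1) : (wt p B i).getD j 0 = B ^ (p - 1 - pv p j i) := by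
  simp [wt, List.getD_eq_getElem?_getD, List.getElem?_range hj]

/-- Length of `rowW`. [folklore] -/
@[simp] theorem length_rowW (p B t : ℕ) : (rowW p B t).length = p := by simp [rowW]

/-- Entries of `rowW`. [folklore] -/
theorem getD_rowW (p B t : ℕ) {u : ℕ} (hu : u < p) : (rowW p B t).getD u [] = wt p B (t * p + u) := by
  simp [rowW, List.getD_eq_getElem?_getD, List.getElem?_range hu]

/-- Length of `rowWs`. [folklore] -/
@[simp] theorem length_rowWs (p B : ℕ) : (rowWs p B).length = p := by simp [rowWs]

/-- Entries of `rowWs`. [folklore] -/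
theorem getD_rowWs (p B : ℕ) {t : ℕ} (ht : t < p) : (rowWs p B).getD t [] = rowW p B t := by
  simp [rowWs, List.getD_eq_getElem?_getD, List.getElem?_range ht]

end ZpZpDomino

end Summit.MatrixMultiplication.OmegaCensus
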